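import Summits.QuantumFields.YangMills.Theorems.SwapVirialDeficitSectorLaplaceBTubeCapStiffThresholds
import HarnessLib

/-!
# STUB (S-B) OF SKELETON ➎ v9, part 2: ★★★ `stub_B_stiff` MODULO THE FAR FLOOR — reading on `chartMeasure L`, sign sum, the stub
# (free-hands support of ⟨stmt-QuantumFields-24197⟩ `SwapVirialDeficit.SwapGluedStiffness` ∕ ⟨24194⟩; cell ym-idea-1, LEAD g99 ruling 2026-08-31 21:25Z (b), assembler fcl-p3 g48)

On top of part 1 (✓`…BTubeCapStiffThresholds`: `hb1 ∕ hrate ∕ habs` of w2 g59's ✓`bTubeCap_stiff_of_farFloor` from the threshold `K·L^k·τ⁻¹^k ≤ b`):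

* §3 ★★ `bTubeCap_stiff_sign` — one good sign pattern on `chartMeasure L` over ✓`BTubeCap L τ 1`, radius `R := min (τ∕3) (min (λ_B∕(8(m_B+8)A₃)) Rfl)`
  (w2's ✓`setIntegral_BTubeCap_exp_eq_hubCot` ∕ ✓`…_action_eq_hubCot`, common factor `coneConst·π`);
* §4 ★★★ `stub_B_stiff_of_farFloor (Rfl) (hKR) (hRfl) (hfloor)` — THE STUB `stub_B_stiff` OF HOME `fcl-p3-g48-SectorStiffnessSkeleton.lean` (➎ v9 = v8's statement)
  VERBATIM, from an abstract admissible far-floor radius `Rfl L τ` (positive, polynomial floor `Rfl⁻¹ ≤ K_R·L^{k_R}·τ⁻¹^{k_R}`) and the far floor `hfloor` in EXACTLY the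
  `hfar` shape of ✓`bTubeCap_stiff_of_farFloor` (`X₁ = 1`) for all `0 < R ≤ Rfl L τ`;  `stub_B_stiff_of_farFloor_pkg (hpkg)` — the same from ONE existential package
  `∃ Rfl KR kR, …` (the shape registered as `stub_B_farFloor` in skeleton ➎ v9, so that w3 g67 chooses `Rfl` freely).

HONEST LABEL: bookkeeping; (S-B) is closed MODULO the far floor `hfloor` (w3 g67, OPEN); (S-core-tip) [w2 g60], (S-core-end) [LEAD g99], (S-001-good) OPEN; ⟨24197⟩ ∕ ⟨24194⟩ OPEN;
item of record ⟨24085⟩ SubOctaveBounded aside ∕ untouched; the Yang–Mills mass gap is NOT proved; no summit is proved by a line.  THEOREMS ONLY (0 `def`, 0 `sorry`), standard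
axioms; the `attribute [local instance]` block is the series' measurable structure on `ℍ` (as in ✓`SectorLaplaceDefs`; nothing overridden).  Seat ym-line-fcl-p3 g48 (cell
ym-idea-1, free hands), `--supports stmt-QuantumFields-24197`.  References: [cite: Luscher1983, §2]; [folklore].
-/

set_option autoImplicit false
set_option synthInstance.maxSize 1024

noncomputable section

open MeasureTheory Quaternion Set
open scoped Quaternion BigOperators ENNReal
open Literature.MathematicalPhysics.QuantumLattice
open Literature.MathematicalPhysics.QuantumFieldTheory hiding SU2
open Summit.QuantumFields.YangMills.Theorems.SwapTwistDeficit.ToronLog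

attribute [local instance] Literature.Analysis.FluidPDE.Tao2016.quatMeasurableSpace
  Literature.Analysis.FluidPDE.Tao2016.quatBorelSpace
  Literature.MathematicalPhysics.QuantumLattice.secondCountableTopology_su2

namespace Summit.QuantumFields.YangMills.Theorems.SwapVirialDeficit.SectorLaplace

open Summit.QuantumFields.YangMills.Theorems.FemtoTransferGap
open Summit.QuantumFields.YangMills.Theorems.FemtoTransferGap.TT
open Summit.QuantumFields.YangMills.Theorems.VirialFluxGap.RingDeficit
open Summit.QuantumFields.YangMills.Theorems.SwapVirialDeficit.SwapRing
open Summit.QuantumFields.YangMills.Theorems.SwapVirialDeficit.BlowUpRing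

variable {L : ℕ} [NeZero L]

/-! ## §3 One good sign pattern on `chartMeasure L` over `BTubeCap L τ 1` -/

set_option maxHeartbeats 800000 in
/-- ★★ **THE CAPPED B-TUBE STIFFNESS FOR ONE GOOD SIGN PATTERN, MODULO THE FAR FLOOR**, at fixed `L`, cut `0 < τ ≤ ½` and `b` above the threshold
`(60000L⁴·290G⁵)⁴`, `G = (4·10¹² + |log(coneConst³∕64)| + K_R)·L^{18+k_R}·τ⁻¹^{2+k_R}`; radius `R = min (τ∕3) (min (λ_B∕(8(m_B+8)A₃)) Rfl)` with `0 < Rfl`,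
`Rfl⁻¹ ≤ K_R·L^{k_R}·τ⁻¹^{k_R}`, and the far floor `hfl` for every `0 < R′ ≤ Rfl` in the `hfar` shape of ✓`bTubeCap_stiff_of_farFloor` (`X₁ = 1`):
`stiffKappa L (1∕8) · ∫_{BTubeCap L τ 1} e^{−bF̂_ε} d(chartMeasure) ≤ b · ∫_{BTubeCap L τ 1} F̂_ε e^{−bF̂_ε} d(chartMeasure)`. [cite: Luscher1983, §2] -/
theorem bTubeCap_stiff_sign (ε : GnoSign L) (hε : GoodSign ε) {τ : ℝ} (hτ : 0 < τ) (hτ2 : τ ≤ 1 / 2)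
    {Rfl KR : ℝ} {kR : ℕ} (hKR : 0 ≤ KR) (hRfl0 : 0 < Rfl) (hRflK : Rfl⁻¹ ≤ KR * (L : ℝ) ^ kR * τ⁻¹ ^ kR)
    (hfl : ∀ R : ℝ, 0 < R → R ≤ Rfl →
      ∀ u : ℝ × ℝ, τ ^ 2 ≤ u.1 ^ 2 + u.2 ^ 2 → ∀ y : GnoFibreB L, R ≤ ‖y‖ → gnoFibreBEquiv (u, gnoScaleB u y) ∈
        ({p : ℝ × GnoCoord L | 4 * p.1 ^ 2 / (1 + p.1 ^ 2) ^ 2 < τ ∧ τ ≤ (1 + p.1 ^ 2)⁻¹ ∧ |p.1| < τ * Real.sqrt (1 + p.1 ^ 2)} ∩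
              {p : ℝ × GnoCoord L | τ ≤ Real.sqrt (p.2.1.1 1 ^ 2 + p.2.1.1 2 ^ 2)} ∩
              {p : ℝ × GnoCoord L | |p.2.1.1 0| ≤ 1 * Real.sqrt (1 + p.2.1.1 1 ^ 2 + p.2.1.1 2 ^ 2)}) →
        τ ^ 2 / ((1 + τ ^ 2) * (12375 * (L : ℝ) ^ 10)) * R ^ 2 ≤
          gnoDeficit (fun _ => false) (fun _ => 1) (hubAt (gnoFibreBEquiv (u, gnoScaleB u y)).1 1) ε (gnoFibreBEquiv (u, gnoScaleB u y)).2)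
    {b : ℝ}
    (hb : (60000 * (L : ℝ) ^ 4 * (290 * ((4000000000000 + |Real.log (coneConst ^ 3 / 64)| + KR) * (L : ℝ) ^ (18 + kR) * τ⁻¹ ^ (2 + kR)) ^ 5)) ^ 4 ≤ b) :
    stiffKappa L (1 / 8) * ∫ x in BTubeCap L τ 1, Real.exp (-(b * gnoDeficit z₀ (fun _ => 1) x.1 ε x.2)) ∂chartMeasure L ≤
      b * ∫ x in BTubeCap L τ 1, gnoDeficit z₀ (fun _ => 1) x.1 ε x.2 * Real.exp (-(b * gnoDeficit z₀ (fun _ => 1) x.1 ε x.2)) ∂chartMeasure L := by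
  obtain ⟨hz, hεF⟩ := hε
  have hL1 : (1 : ℝ) ≤ L := by exact_mod_cast NeZero.one_le
  have hL0 : (0 : ℝ) < L := by linarith
  have hL4 : (1 : ℝ) ≤ (L : ℝ) ^ 4 := one_le_pow₀ hL1
  have hτi : 2 ≤ τ⁻¹ := by rw [le_inv_comm₀ (by norm_num) hτ]; rw [show (2 : ℝ)⁻¹ = 1 / 2 by norm_num]; exact hτ2
  have hτi1 : 1 ≤ τ⁻¹ := by linarith
  have hc₀0 : 0 ≤ |Real.log (coneConst ^ 3 / 64)| := abs_nonneg _
  -- the master quantity `G`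
  obtain ⟨G, hG⟩ : ∃ G : ℝ, G = (4000000000000 + |Real.log (coneConst ^ 3 / 64)| + KR) * (L : ℝ) ^ (18 + kR) * τ⁻¹ ^ (2 + kR) := ⟨_, rfl⟩
  rw [← hG] at hb
  have hC0 : 0 ≤ 4000000000000 + |Real.log (coneConst ^ 3 / 64)| + KR := by positivity
  have hlam0 : 0 < τ ^ 2 / ((1 + τ ^ 2) * (12375 * (L : ℝ) ^ 10)) := by positivity
  have hm80 : 0 < (Module.finrank ℝ (GnoFibreB L) : ℝ) + 8 := by positivity
  have hA0 : (0 : ℝ) < 1136016 * (L : ℝ) ^ 4 := by positivity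
  have hG_ge : ∀ {K' : ℝ} {i j : ℕ}, 0 ≤ K' → K' ≤ 4000000000000 + |Real.log (coneConst ^ 3 / 64)| + KR → i ≤ 18 + kR → j ≤ 2 + kR →
      K' * (L : ℝ) ^ i * τ⁻¹ ^ j ≤ G := by
    intro K' i j hK' hK'C hi hj
    rw [hG]
    exact mul_le_mul (mul_le_mul hK'C (pow_le_pow_right₀ hL1 hi) (by positivity) hC0) (pow_le_pow_right₀ hτi1 hj) (by positivity) (by positivity)
  have hG1 : 1 ≤ G := by
    have h := hG_ge (K' := 1) (i := 0) (j := 0) zero_le_one (by linarith) (by omega) (by omega)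
    simpa using h
  have hG0 : 0 < G := by linarith
  -- `λ⁻¹ ≤ G`
  have hlaminv := lambdaB_inv_le (L := L) hτ hτ2
  have hlamG : (τ ^ 2 / ((1 + τ ^ 2) * (12375 * (L : ℝ) ^ 10)))⁻¹ ≤ G :=
    hlaminv.trans (hG_ge (by norm_num) (by linarith) (by omega) (by omega))
  -- `m_B + 8 ≤ G`
  have hm8le : (Module.finrank ℝ (GnoFibreB L) : ℝ) + 8 ≤ 25 * (L : ℝ) ^ 4 := finrankB_add_eight_le (L := L)
  have hm8G : (Module.finrank ℝ (GnoFibreB L) : ℝ) + 8 ≤ G := by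
    have h := hG_ge (K' := 25) (i := 4) (j := 0) (by norm_num) (by linarith) (by omega) (by omega)
    rw [pow_zero, mul_one] at h
    exact hm8le.trans h
  -- `A₃ ≤ G`
  have hAG : 1136016 * (L : ℝ) ^ 4 ≤ G := by
    have h := hG_ge (K' := 1136016) (i := 4) (j := 0) (by norm_num) (by linarith) (by omega) (by omega)
    rw [pow_zero, mul_one] at h
    exact h
  -- the radius
  obtain ⟨R, hR⟩ : ∃ R : ℝ, R = min (τ / 3) (min (τ ^ 2 / ((1 + τ ^ 2) * (12375 * (L : ℝ) ^ 10)) /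
      (8 * ((Module.finrank ℝ (GnoFibreB L) : ℝ) + 8) * (1136016 * (L : ℝ) ^ 4))) Rfl) := ⟨_, rfl⟩
  have hR0 : 0 < R := by rw [hR]; exact lt_min (by positivity) (lt_min (by positivity) hRfl0)
  have hRτ3 : R ≤ τ / 3 := by rw [hR]; exact min_le_left _ _
  have hRsm : R ≤ τ ^ 2 / ((1 + τ ^ 2) * (12375 * (L : ℝ) ^ 10)) / (8 * ((Module.finrank ℝ (GnoFibreB L) : ℝ) + 8) * (1136016 * (L : ℝ) ^ 4)) := by
    rw [hR]; exact (min_le_right _ _).trans (min_le_left _ _)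
  have hRfl : R ≤ Rfl := by rw [hR]; exact (min_le_right _ _).trans (min_le_right _ _)
  have hRsix : R ≤ 1 / 6 := by linarith
  have hR1 : R ≤ 1 := by linarith
  have hRτ : 2 * R < τ := by linarith
  have hDR : 2 * R * R ≤ 1 := by
    have h : R * R ≤ 1 / 6 * 1 := mul_le_mul hRsix hR1 hR0.le (by norm_num)
    linarith
  have hsmall : 1136016 * (L : ℝ) ^ 4 * R ≤ τ ^ 2 / ((1 + τ ^ 2) * (12375 * (L : ℝ) ^ 10)) / (8 * ((Module.finrank ℝ (GnoFibreB L) : ℝ) + 8)) := by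
    have h1 := mul_le_mul_of_nonneg_left hRsm hA0.le
    have h2 : 1136016 * (L : ℝ) ^ 4 * (τ ^ 2 / ((1 + τ ^ 2) * (12375 * (L : ℝ) ^ 10)) /
        (8 * ((Module.finrank ℝ (GnoFibreB L) : ℝ) + 8) * (1136016 * (L : ℝ) ^ 4))) =
        τ ^ 2 / ((1 + τ ^ 2) * (12375 * (L : ℝ) ^ 10)) / (8 * ((Module.finrank ℝ (GnoFibreB L) : ℝ) + 8)) := by
      field_simp
    linarith [h1, h2.le, h2.ge]
  -- `R⁻¹ ≤ G`, i.e. `G⁻¹ ≤ R`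
  have hRG : R⁻¹ ≤ G := by
    rw [inv_le_comm₀ hR0 hG0, hR]
    refine le_min ?_ (le_min ?_ ?_)
    · -- `G⁻¹ ≤ τ/3`, i.e. `3τ⁻¹ ≤ G`
      have h := hG_ge (K' := 3) (i := 0) (j := 1) (by norm_num) (by linarith) (by omega) (by omega)
      rw [pow_zero, mul_one, pow_one] at h
      rw [inv_le_comm₀ hG0 (by positivity : (0 : ℝ) < τ / 3), inv_div, div_eq_mul_inv]
      exact h
    · -- `G⁻¹ ≤ λ/(8 m₈ A₃)`, i.e. `8 m₈ A₃ λ⁻¹ ≤ G`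
      have hprod : 8 * ((Module.finrank ℝ (GnoFibreB L) : ℝ) + 8) * (1136016 * (L : ℝ) ^ 4) * (τ ^ 2 / ((1 + τ ^ 2) * (12375 * (L : ℝ) ^ 10)))⁻¹ ≤ G := by
        have h1 : 8 * ((Module.finrank ℝ (GnoFibreB L) : ℝ) + 8) * (1136016 * (L : ℝ) ^ 4) * (τ ^ 2 / ((1 + τ ^ 2) * (12375 * (L : ℝ) ^ 10)))⁻¹ ≤
            8 * (25 * (L : ℝ) ^ 4) * (1136016 * (L : ℝ) ^ 4) * (15469 * (L : ℝ) ^ 10 * τ⁻¹ ^ 2) :=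
          mul_le_mul (mul_le_mul_of_nonneg_right (mul_le_mul_of_nonneg_left hm8le (by norm_num)) hA0.le) hlaminv
            (inv_pos.2 hlam0).le (by positivity)
        have h2 : 8 * (25 * (L : ℝ) ^ 4) * (1136016 * (L : ℝ) ^ 4) * (15469 * (L : ℝ) ^ 10 * τ⁻¹ ^ 2) =
            (8 * 25 * 1136016 * 15469) * (L : ℝ) ^ 18 * τ⁻¹ ^ 2 := by ring
        have h3 := hG_ge (K' := 8 * 25 * 1136016 * 15469) (i := 18) (j := 2) (by norm_num) (by norm_num; linarith) (by omega) (by omega)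
        linarith [h1, h2.le, h3]
      rw [inv_le_comm₀ hG0 (by positivity), inv_div, div_eq_mul_inv]
      exact hprod
    · -- `G⁻¹ ≤ Rfl`
      rw [inv_le_comm₀ hG0 hRfl0]
      exact hRflK.trans (hG_ge hKR (by linarith) (by omega) (by omega))
  -- the bracket `Br ≤ G`
  have hBrG : 4 * (9 * (L : ℝ) ^ 4 + 1) + (6 + |Real.log (coneConst ^ 3 / 64)| + 18 * (L : ℝ) ^ 4 + 719712 * (L : ℝ) ^ 8) ≤ G := by
    have hL8 : (L : ℝ) ^ 4 ≤ (L : ℝ) ^ 8 := pow_le_pow_right₀ hL1 (by norm_num)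
    have hL8' : (1 : ℝ) ≤ (L : ℝ) ^ 8 := one_le_pow₀ hL1
    have hc : |Real.log (coneConst ^ 3 / 64)| ≤ |Real.log (coneConst ^ 3 / 64)| * (L : ℝ) ^ 8 := le_mul_of_one_le_right hc₀0 hL8'
    have h1 : 4 * (9 * (L : ℝ) ^ 4 + 1) + (6 + |Real.log (coneConst ^ 3 / 64)| + 18 * (L : ℝ) ^ 4 + 719712 * (L : ℝ) ^ 8) ≤
        (719776 + |Real.log (coneConst ^ 3 / 64)|) * (L : ℝ) ^ 8 := by
      have e : (719776 + |Real.log (coneConst ^ 3 / 64)|) * (L : ℝ) ^ 8 = 719776 * (L : ℝ) ^ 8 + |Real.log (coneConst ^ 3 / 64)| * (L : ℝ) ^ 8 := by ring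
      rw [e]; linarith
    have h2 := hG_ge (K' := 719776 + |Real.log (coneConst ^ 3 / 64)|) (i := 8) (j := 0) (by positivity) (by linarith) (by omega) (by omega)
    rw [pow_zero, mul_one] at h2
    exact h1.trans h2
  -- the threshold arithmetic
  obtain ⟨hb1, hrate, hbr⟩ := bTube_threshold_arith
    (Br := 4 * (9 * (L : ℝ) ^ 4 + 1) + (6 + |Real.log (coneConst ^ 3 / 64)| + 18 * (L : ℝ) ^ 4 + 719712 * (L : ℝ) ^ 8))
    hL4 hG1 hlam0 hlamG hm80 hm8G hA0.le hAG hR0 hR1 hRG hBrG hb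
  have habs : ∀ t : ℝ, b ≤ t → t ≤ 2 * b →
      Real.exp (-(t * (τ ^ 2 / ((1 + τ ^ 2) * (12375 * (L : ℝ) ^ 10)) * R ^ 2))) * (Real.pi * Real.exp (|Real.log (coneConst ^ 3 / 64)| + 18 * (L : ℝ) ^ 4)) ≤
        t ^ (-(1 / 4 : ℝ)) * ((2 * Real.pi / t) ^ ((Module.finrank ℝ (GnoFibreB L) : ℝ) / 2) *
          ((4 / 81) / Real.sqrt ((39984 * (L : ℝ) ^ 4) ^ Module.finrank ℝ (GnoFibreB L)))) :=
    fun t hbt _ => bTube_habs (L := L) (hb1.trans hbt) (hbr t hbt)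
  -- the far floor at `R`
  have hfar := hfl R hR0 hRfl
  -- w2's capped B-tube stiffness in the letters `(δ, η)`
  have hstiff := bTubeCap_stiff_of_farFloor ε hz hεF hτ hτ2 (X₁ := 1) hR0 hR1 hRτ hsmall hDR hfar hb1 hrate habs
  -- read both sides on `chartMeasure L`
  rw [setIntegral_BTubeCap_exp_eq_hubCot z₀ (fun _ => 1) ε τ 1 b, setIntegral_BTubeCap_action_eq_hubCot z₀ (fun _ => 1) ε τ 1 b]
  have hcπ : 0 < coneConst * Real.pi := mul_pos coneConst_pos Real.pi_pos
  have h2 := mul_le_mul_of_nonneg_left hstiff hcπ.le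
  calc stiffKappa L (1 / 8) * (coneConst * Real.pi * _) = coneConst * Real.pi * (stiffKappa L (1 / 8) * _) := by ring
    _ ≤ coneConst * Real.pi * (b * _) := h2
    _ = b * (coneConst * Real.pi * _) := by ring

/-! ## §4 The stub -/

set_option maxHeartbeats 800000 in
/-- ★★★ **`stub_B_stiff` OF SKELETON ➎ (v9 = v8's statement) MODULO THE FAR FLOOR.**  Given an admissible far-floor radius `Rfl L τ > 0` with a polynomial floor
`(Rfl L τ)⁻¹ ≤ K_R·L^{k_R}·τ⁻¹^{k_R}` (`0 < τ ≤ ½`) and the FAR FLOOR `hfloor` — for every `L`, every good sign pattern, every cut `0 < τ ≤ ½` and every radius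
`0 < R ≤ Rfl L τ`, the `hfar` hypothesis of ✓`bTubeCap_stiff_of_farFloor` with `X₁ = 1` (w3 g67) — the capped B-tubes carry plain stiffness above a polynomial
threshold: `∃ K > 0, k, τ₀ ∈ (0, ½]: ∀ L, ∀ 0 < τ ≤ τ₀∕L^k, ∀ b ≥ K·L^k·τ⁻¹^k`,
`stiffKappa L (1∕8) · Σ_good ∫_{BTubeCap L τ 1} e^{−bF̂} d(chartMeasure) ≤ b · Σ_good ∫_{BTubeCap L τ 1} F̂e^{−bF̂} d(chartMeasure)`. [cite: Luscher1983, §2] -/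
theorem stub_B_stiff_of_farFloor (Rfl : ℕ → ℝ → ℝ) {KR : ℝ} {kR : ℕ} (hKR : 0 ≤ KR)
    (hRfl : ∀ (L : ℕ) [NeZero L] (τ : ℝ), 0 < τ → τ ≤ 1 / 2 → 0 < Rfl L τ ∧ (Rfl L τ)⁻¹ ≤ KR * (L : ℝ) ^ kR * τ⁻¹ ^ kR)
    (hfloor : ∀ (L : ℕ) [NeZero L] (ε : GnoSign L), ε.2.1 = true → (ε.2.2 = fun _ => true) → ∀ τ : ℝ, 0 < τ → τ ≤ 1 / 2 →
      ∀ R : ℝ, 0 < R → R ≤ Rfl L τ →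
        ∀ u : ℝ × ℝ, τ ^ 2 ≤ u.1 ^ 2 + u.2 ^ 2 → ∀ y : GnoFibreB L, R ≤ ‖y‖ → gnoFibreBEquiv (u, gnoScaleB u y) ∈
          ({p : ℝ × GnoCoord L | 4 * p.1 ^ 2 / (1 + p.1 ^ 2) ^ 2 < τ ∧ τ ≤ (1 + p.1 ^ 2)⁻¹ ∧ |p.1| < τ * Real.sqrt (1 + p.1 ^ 2)} ∩
                {p : ℝ × GnoCoord L | τ ≤ Real.sqrt (p.2.1.1 1 ^ 2 + p.2.1.1 2 ^ 2)} ∩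
                {p : ℝ × GnoCoord L | |p.2.1.1 0| ≤ 1 * Real.sqrt (1 + p.2.1.1 1 ^ 2 + p.2.1.1 2 ^ 2)}) →
          τ ^ 2 / ((1 + τ ^ 2) * (12375 * (L : ℝ) ^ 10)) * R ^ 2 ≤
            gnoDeficit (fun _ => false) (fun _ => 1) (hubAt (gnoFibreBEquiv (u, gnoScaleB u y)).1 1) ε (gnoFibreBEquiv (u, gnoScaleB u y)).2) :
    ∃ K : ℝ, 0 < K ∧ ∃ k : ℕ, ∃ τ₀ : ℝ, 0 < τ₀ ∧ τ₀ ≤ 1 / 2 ∧ ∀ (L : ℕ) [NeZero L] (τ : ℝ), 0 < τ → τ ≤ τ₀ / (L : ℝ) ^ k →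
      ∀ b : ℝ, K * (L : ℝ) ^ k * τ⁻¹ ^ k ≤ b →
        stiffKappa L (1 / 8) * ∑ ε ∈ (Finset.univ.filter fun ε : GnoSign L => GoodSign ε),
            ∫ x in BTubeCap L τ 1, Real.exp (-(b * gnoDeficit z₀ (fun _ => 1) x.1 ε x.2)) ∂chartMeasure L ≤
          b * ∑ ε ∈ (Finset.univ.filter fun ε : GnoSign L => GoodSign ε),
            ∫ x in BTubeCap L τ 1, gnoDeficit z₀ (fun _ => 1) x.1 ε x.2 * Real.exp (-(b * gnoDeficit z₀ (fun _ => 1) x.1 ε x.2)) ∂chartMeasure L := by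
  have hC0 : (0 : ℝ) < 4000000000000 + |Real.log (coneConst ^ 3 / 64)| + KR := by positivity
  refine ⟨(60000 * 290 * (4000000000000 + |Real.log (coneConst ^ 3 / 64)| + KR) ^ 5) ^ 4, by positivity, 4 * (4 + 5 * (18 + kR)), 1 / 2,
    by norm_num, le_rfl, fun L _ τ hτ hτle b hb => ?_⟩
  have hL1 : (1 : ℝ) ≤ L := by exact_mod_cast NeZero.one_le
  have hLk : (1 : ℝ) ≤ (L : ℝ) ^ (4 * (4 + 5 * (18 + kR))) := one_le_pow₀ hL1
  have hτ2 : τ ≤ 1 / 2 := hτle.trans (div_le_self (by norm_num) hLk)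
  have hτi1 : 1 ≤ τ⁻¹ := by rw [one_le_inv₀ hτ]; linarith
  -- the threshold of §3
  have hbG : (60000 * (L : ℝ) ^ 4 * (290 * ((4000000000000 + |Real.log (coneConst ^ 3 / 64)| + KR) * (L : ℝ) ^ (18 + kR) * τ⁻¹ ^ (2 + kR)) ^ 5)) ^ 4 ≤ b :=
    (bTube_threshold_monomial hL1 hτi1).trans hb
  obtain ⟨hRfl0, hRflK⟩ := hRfl L τ hτ hτ2
  rw [Finset.mul_sum, Finset.mul_sum]
  refine Finset.sum_le_sum fun ε hε => ?_
  have hgood : GoodSign ε := (Finset.mem_filter.1 hε).2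
  exact bTubeCap_stiff_sign ε hgood hτ hτ2 hKR hRfl0 hRflK (fun R hR0 hRle => hfloor L ε hgood.1 hgood.2 τ hτ hτ2 R hR0 hRle) hbG

/-- ★★★ **`stub_B_stiff` FROM THE FAR-FLOOR PACKAGE** — the same with the radius function, its polynomial floor and the far floor bundled into ONE existential
hypothesis (the shape registered as `stub_B_farFloor` in skeleton ➎ v9, so that w3 g67 chooses `Rfl` freely). [cite: Luscher1983, §2] -/
theorem stub_B_stiff_of_farFloor_pkg
    (hpkg : ∃ Rfl : ℕ → ℝ → ℝ, ∃ KR : ℝ, ∃ kR : ℕ, 0 ≤ KR ∧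
      (∀ (L : ℕ) [NeZero L] (τ : ℝ), 0 < τ → τ ≤ 1 / 2 → 0 < Rfl L τ ∧ (Rfl L τ)⁻¹ ≤ KR * (L : ℝ) ^ kR * τ⁻¹ ^ kR) ∧
      (∀ (L : ℕ) [NeZero L] (ε : GnoSign L), ε.2.1 = true → (ε.2.2 = fun _ => true) → ∀ τ : ℝ, 0 < τ → τ ≤ 1 / 2 →
        ∀ R : ℝ, 0 < R → R ≤ Rfl L τ →
          ∀ u : ℝ × ℝ, τ ^ 2 ≤ u.1 ^ 2 + u.2 ^ 2 → ∀ y : GnoFibreB L, R ≤ ‖y‖ → gnoFibreBEquiv (u, gnoScaleB u y) ∈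
            ({p : ℝ × GnoCoord L | 4 * p.1 ^ 2 / (1 + p.1 ^ 2) ^ 2 < τ ∧ τ ≤ (1 + p.1 ^ 2)⁻¹ ∧ |p.1| < τ * Real.sqrt (1 + p.1 ^ 2)} ∩
                  {p : ℝ × GnoCoord L | τ ≤ Real.sqrt (p.2.1.1 1 ^ 2 + p.2.1.1 2 ^ 2)} ∩
                  {p : ℝ × GnoCoord L | |p.2.1.1 0| ≤ 1 * Real.sqrt (1 + p.2.1.1 1 ^ 2 + p.2.1.1 2 ^ 2)}) →
            τ ^ 2 / ((1 + τ ^ 2) * (12375 * (L : ℝ) ^ 10)) * R ^ 2 ≤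
              gnoDeficit (fun _ => false) (fun _ => 1) (hubAt (gnoFibreBEquiv (u, gnoScaleB u y)).1 1) ε (gnoFibreBEquiv (u, gnoScaleB u y)).2)) :
    ∃ K : ℝ, 0 < K ∧ ∃ k : ℕ, ∃ τ₀ : ℝ, 0 < τ₀ ∧ τ₀ ≤ 1 / 2 ∧ ∀ (L : ℕ) [NeZero L] (τ : ℝ), 0 < τ → τ ≤ τ₀ / (L : ℝ) ^ k →
      ∀ b : ℝ, K * (L : ℝ) ^ k * τ⁻¹ ^ k ≤ b →
        stiffKappa L (1 / 8) * ∑ ε ∈ (Finset.univ.filter fun ε : GnoSign L => GoodSign ε),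
            ∫ x in BTubeCap L τ 1, Real.exp (-(b * gnoDeficit z₀ (fun _ => 1) x.1 ε x.2)) ∂chartMeasure L ≤
          b * ∑ ε ∈ (Finset.univ.filter fun ε : GnoSign L => GoodSign ε),
            ∫ x in BTubeCap L τ 1, gnoDeficit z₀ (fun _ => 1) x.1 ε x.2 * Real.exp (-(b * gnoDeficit z₀ (fun _ => 1) x.1 ε x.2)) ∂chartMeasure L := by
  obtain ⟨Rfl, KR, kR, hKR, hRfl, hfloor⟩ := hpkg
  exact stub_B_stiff_of_farFloor Rfl hKR (fun L _ τ hτ hτ2 => hRfl L τ hτ hτ2) (fun L _ ε hz hε τ hτ hτ2 R hR hRle => hfloor L ε hz hε τ hτ hτ2 R hR hRle)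

end Summit.QuantumFields.YangMills.Theorems.SwapVirialDeficit.SectorLaplace

end
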